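import Literature.Topology.FourManifolds.TrisectionsSectorThreeFunction
import Literature.Topology.FourManifolds.TrisectionsSectorMorse
import Literature.Topology.FourManifolds.MorseTurnAbout
import Literature.Topology.FourManifolds.HCobordismTradeStep
import HarnessLib

/-!
# The handle decomposition of the straightened third sector `X₃` ("`X₃ ≅ ♮ᵏ S¹ × B³`",
# Gay–Kirby 2016, Lemma 14)

Topic `Literature/Topology/FourManifolds`; for the fact seat
`provefact-Literature.Topology.FourManifolds.exists_isBalancedGKTrisection` (Gay–Kirby 2016,
Thm. 4 via Lemma 14).  Everything in this file is **proved**; no named facts are introduced.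

Gay–Kirby, proof of Lemma 14: *"`X₁` and `X₃` are both diffeomorphic to `♮ᵏ S¹ × B³`"* — for
`X₃` ("what remains") this is the upside-down reading of the Morse function `f` above the top
level `c = 5/2` (the `3`- and `4`-handles).  For the sector `X₃ = TriData.X₃` with its
straightened structure `TriData.cornerSliceAtlas₃` (corners along `F`, faces the bevel face
and `H₂₃`) we feed the adapted function `F₃ = secFun₃` of `TrisectionsSectorThreeFunction.lean`
into `CornerSliceAtlas.hasHandleDecomposition_of_comp_val` (`TrisectionsSectorMorse.lean`):
the critical points of `F₃` interior to `X₃` are the critical points of `f` above `c`, near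
which `F₃ = (1 + (1 + S) c) - (1 + S) f` is affine decreasing in `f` (gap hypothesis), so
that they are nondegenerate with Morse index `4 - index_f` (Milnor's turning about,
`MorseTurnAbout.lean`).  Result (`hasHandleDecomposition_X₃`): **`HasHandleDecomposition 3 ↥X₃ c`
with `c i` the number of critical points of `f` of index `4 - i` above `c`** (`i ≤ 4`); with
one critical point of index `4` and `k` of index `3` above `c` this is `handleCount 1 k` — the
hypothesis `h₃` of `isGKTrisection_of_handles`.

## References

* D. Gay, R. Kirby, *Trisecting 4-manifolds*, Geom. Topol. 20 (2016) 3097–3132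
  (arXiv:1205.1565): §4, Lemma 14 and its proof. [GayKirby2016]
* J. Milnor, *Lectures on the h-cobordism theorem* (1965), proof of Thm. 9.1 (turning the
  triad about). [MilnorHCobordism1965]
-/

open scoped Manifold ContDiff Topology
open Set Function Filter

noncomputable section

universe u

namespace Literature.Topology.FourManifolds

variable {X : Type u} [TopologicalSpace X] [T2Space X] [CompactSpace X]
  [ChartedSpace (EuclideanSpace ℝ (Fin 4)) X] [IsManifold (𝓡 4) ∞ X]

namespace BiCollar

namespace TriData

namespace SectorThreeParams

variable {B : BiCollar X} {T : B.TriData} (P : T.SectorThreeParams)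
  (hc2 : B.a + B.U.δ + 2 * T.ε ≤ T.c) {η : ℝ} (hη : 2 * T.ε ≤ η)
  (hL : ∀ q : X, IsMCriticalPt (𝓡 4) B.f q → B.a < B.f q → B.f q ≤ T.c →
    ∀ y : B.Y, RegularLevel.incl B.hf y ∈ stableSet (𝓡 4) B.U.ξ q → B.g y < B.b - η)

/-! ### The affine form above the top transition -/

/-- **High up, `F₃ = (1 + (1 + S) c) - (1 + S) f` near the point.** [folklore] -/
theorem secFun₃_eventuallyEq_affine {p : X} (hp : P.S + P.σ₀ < B.sFun p) :
    P.secFun₃ =ᶠ[𝓝 p] fun y => (1 + (1 + P.S) * T.c) - ((1 + P.S) * B.f y + 0) := by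
  filter_upwards [(isOpen_lt continuous_const B.contMDiff_sFun.continuous).mem_nhds hp] with y hy
  have hy' : P.S + P.σ₀ < B.sFun y := hy
  have hΞ : P.xiS y = 1 + P.S := xiFun_of_le P.σ₀_pos P.S_nonneg hy'.le
  have hω : T.omegaFun y = 1 :=
    T.omegaFun_of_ge (by linarith [T.mid_lt_δ, P.δ_le_S, P.σ₀_pos])
  have hM : T.Mt y = B.f y - T.c := T.Mt_eq_sub_of_le_f P.abs_gFun_le (by
    have hS : P.S = T.c + P.Γ + T.ε - B.a := rfl
    rw [B.f_eq_add_sFun]; linarith [P.σ₀_pos])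
  rw [secFun₃, Lam, hΞ, hω, hM]; ring

include hη hL in
/-- **A critical point of `f` in `X₃` lies high up** (it does not hit, so `c ≤ f`; `c` is
regular, so `c < f`; gap). [folklore] -/
theorem sFun_gt_of_isMCriticalPt_f {p : X} (hp3 : p ∈ T.X₃) (hc : IsMCriticalPt (𝓡 4) B.f p) :
    P.S + P.σ₀ < B.sFun p := by
  have hh : ¬ B.Hit p := fun h => T.Fr.not_isMCriticalPt_of_hit h hc
  have hcf := T.c_le_f_of_mem_X₃_of_not_hit hη hL hp3 hh
  have hne : B.f p ≠ T.c := fun h => T.regular_c p h hc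
  rcases P.gap p hc with h | h
  · exact absurd (le_antisymm h hcf) hne
  · have hS : P.S = T.c + P.Γ + T.ε - B.a := rfl
    rw [sFun]; linarith

include hc2 hη hL in
/-- **The critical points of `F₃` interior to `X₃` are critical points of `f`** (elsewhere the
flow derivative is negative). [folklore] -/
theorem isMCriticalPt_f_of_interior {p : X} (hp3 : p ∈ T.X₃) (h0 : T.D.F₁ p ≠ 0) (hM : T.Mt p ≠ 0)
    (hc : IsMCriticalPt (𝓡 4) P.secFun₃ p) : IsMCriticalPt (𝓡 4) B.f p := by
  by_contra hcrit
  exact P.not_isMCriticalPt_secFun₃_of_interior hc2 hη hL hp3 h0 hM hcrit hc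

/-- A critical point of `f` above `c` is an interior point of `X₃`: `F₁ > 0` and `M̃ > 0`. [folklore] -/
theorem interior_of_isMCriticalPt_f {p : X} (hc : IsMCriticalPt (𝓡 4) B.f p) (hcp : T.c < B.f p) :
    p ∈ T.X₃ ∧ p ∉ B.surface ∧ T.D.F₁ p ≠ 0 ∧ T.Mt p ≠ 0 := by
  have hp3 : p ∈ T.X₃ := T.mem_X₃_of_le hcp.le
  have hh : ¬ B.Hit p := fun h => T.Fr.not_isMCriticalPt_of_hit h hc
  have hs : B.U.δ ≤ B.sFun p := by rw [sFun]; linarith [T.band_le_c]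
  have hF₁ : 0 < T.D.F₁ p := by
    have hθ : T.D.θ p = 0 := T.D.θ_eq_zero_of_le (by rw [abs_of_pos (by linarith [B.U.δ_pos])]; linarith [T.D.rOut₁_lt])
    show 0 < B.sFun p + T.D.κ * T.D.θ p
    rw [hθ, mul_zero, add_zero]; linarith [B.U.δ_pos]
  refine ⟨hp3, fun h => hF₁.ne' (T.D.F₁_eq_zero_of_mem_surface h), hF₁.ne', ?_⟩
  rw [T.Mt_of_not_hit hh]; linarith

/-! ### The handle decomposition -/

/-- **The count**: `c i` = number of critical points of `f` of index `4 - i` above `c`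
(`i ≤ 4`; `0` for `i > 4`). [cite: GayKirby2016, §4, Lemma 14] -/
def countAbove (B : BiCollar X) (T : B.TriData) (i : ℕ) : ℕ :=
  if i ≤ 4 then (criticalSetOfIndex (𝓡 4) B.f (4 - i) ∩ B.f ⁻¹' Ioi T.c).ncard else 0

include hc2 hη hL in
/-- **The interior critical points of `F₃` of index `i` are the critical points of `f` of index
`4 - i` above `c`.** [cite: MilnorHCobordism1965, Thm. 9.1 (turning about)] -/
theorem image_interior_inter_criticalSetOfIndex (i : ℕ) :
    letI := (T.cornerSliceAtlas₃ hc2 hη hL).chartedSpace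
    (Subtype.val : T.X₃ → X) '' ((𝓡∂ 4).interior T.X₃) ∩ criticalSetOfIndex (𝓡 4) P.secFun₃ i =
      if i ≤ 4 then criticalSetOfIndex (𝓡 4) B.f (4 - i) ∩ B.f ⁻¹' Ioi T.c else ∅ := by
  letI := (T.cornerSliceAtlas₃ hc2 hη hL).chartedSpace
  have hSpos : 0 < 1 + P.S := by linarith [P.S_nonneg]
  have hg : IsMorse (𝓡 4) fun y => (1 + P.S) * B.f y + 0 := T.Fr.isMorse.const_mul_add hSpos.ne' 0
  have hfin : Module.finrank ℝ (EuclideanSpace ℝ (Fin 4)) = 4 := finrank_euclideanSpace_fin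
  -- pointwise analysis at a critical point of `f` in `X₃`
  have key : ∀ p : X, IsMCriticalPt (𝓡 4) B.f p → P.S + P.σ₀ < B.sFun p →
      (IsMCriticalPt (𝓡 4) P.secFun₃ p ↔ IsMCriticalPt (𝓡 4) B.f p) ∧
      ∀ k, (p ∈ criticalSetOfIndex (𝓡 4) P.secFun₃ k ↔
        p ∈ criticalSetOfIndex (𝓡 4) (fun y => (1 + (1 + P.S) * T.c) - ((1 + P.S) * B.f y + 0)) k) := by
    intro p hcf hs
    have hev := P.secFun₃_eventuallyEq_affine hs
    have hev0 : P.secFun₃ =ᶠ[𝓝 p] fun y => ((1 + (1 + P.S) * T.c) - ((1 + P.S) * B.f y + 0)) + 0 :=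
      hev.trans (Eventually.of_forall fun y => (add_zero _).symm)
    have hcrit := isMCriticalPt_congr_of_eventuallyEq_add_const (I := 𝓡 4) hev0
    have hd : MDifferentiableAt (𝓡 4) 𝓘(ℝ, ℝ) (fun y => (1 + P.S) * B.f y + 0) p :=
      hg.contMDiff.mdifferentiableAt (by simp)
    refine ⟨hcrit.trans ((isMCriticalPt_const_sub_iff _ hd).trans
      (isMCriticalPt_const_mul_add_iff hSpos.ne' 0 (B.U.contMDiff_f.mdifferentiableAt (by simp)))), fun k => ?_⟩
    simp only [mem_criticalSetOfIndex]
    rw [hcrit, morseIndex_congr_of_eventuallyEq_add_const hev0]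
  ext x
  simp only [mem_inter_iff, mem_image]
  constructor
  · rintro ⟨⟨p, hp, rfl⟩, hx⟩
    have hint : (𝓡∂ 4).IsInteriorPoint p := hp
    obtain ⟨hpF, h0, hM⟩ := (T.isInteriorPoint_iff₃ hc2 hη hL p).1 hint
    have hcf : IsMCriticalPt (𝓡 4) B.f p.1 := P.isMCriticalPt_f_of_interior hc2 hη hL p.2 h0 hM hx.1
    have hs := P.sFun_gt_of_isMCriticalPt_f hη hL p.2 hcf
    have hcp : T.c < B.f p.1 := by
      have hS : P.S = T.c + P.Γ + T.ε - B.a := rfl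
      rw [B.f_eq_add_sFun]; linarith [P.Γ_nonneg, T.ε_pos, P.σ₀_pos]
    obtain ⟨-, hk⟩ := key p.1 hcf hs
    have hx' := (hk i).1 hx
    by_cases hi : i ≤ 4
    · rw [if_pos hi]
      rw [hg.criticalSetOfIndex_const_sub _ (by rw [hfin]; exact hi), hfin,
        T.Fr.isMorse.criticalSetOfIndex_const_mul_add hSpos 0] at hx'
      exact ⟨hx', hcp⟩
    · exfalso
      have hle := morseIndex_le_finrank (I := 𝓡 4) (fun y => (1 + (1 + P.S) * T.c) - ((1 + P.S) * B.f y + 0)) p.1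
      rw [hfin] at hle
      rw [mem_criticalSetOfIndex] at hx'
      omega
  · intro hx
    by_cases hi : i ≤ 4
    · rw [if_pos hi] at hx
      obtain ⟨hxi, hcp⟩ := hx
      have hcf : IsMCriticalPt (𝓡 4) B.f x := (mem_criticalSetOfIndex.1 hxi).1
      obtain ⟨hp3, hpF, h0, hM⟩ := interior_of_isMCriticalPt_f hcf hcp
      have hs := P.sFun_gt_of_isMCriticalPt_f hη hL hp3 hcf
      obtain ⟨-, hk⟩ := key x hcf hs
      refine ⟨⟨⟨x, hp3⟩, (T.isInteriorPoint_iff₃ hc2 hη hL ⟨x, hp3⟩).2 ⟨hpF, h0, hM⟩, rfl⟩, (hk i).2 ?_⟩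
      rw [hg.criticalSetOfIndex_const_sub _ (by rw [hfin]; exact hi), hfin,
        T.Fr.isMorse.criticalSetOfIndex_const_mul_add hSpos 0]
      exact hxi
    · rw [if_neg hi] at hx; exact absurd hx (notMem_empty _)

include P hc2 hη hL in
/-- **The handle decomposition of the straightened third sector**: one handle of index `i` per
critical point of `f` of index `4 - i` above the top level `c` (Gay–Kirby: "`X₃` is
`♮ᵏ S¹ × B³`"; Milnor's turned-about `Mᵃ`, here with the corner along `F`).
[cite: GayKirby2016, §4, Lemma 14; MilnorHCobordism1965, Thm. 9.1] -/
theorem hasHandleDecomposition_X₃ :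
    letI := (T.cornerSliceAtlas₃ hc2 hη hL).chartedSpace
    HasHandleDecomposition 3 T.X₃ (countAbove B T) := by
  letI := (T.cornerSliceAtlas₃ hc2 hη hL).chartedSpace
  have hSpos : 0 < 1 + P.S := by linarith [P.S_nonneg]
  have hg : IsMorse (𝓡 4) fun y => (1 + P.S) * B.f y + 0 := T.Fr.isMorse.const_mul_add hSpos.ne' 0
  have hg' : IsMorse (𝓡 4) fun y => (1 + (1 + P.S) * T.c) - ((1 + P.S) * B.f y + 0) := hg.const_sub _
  refine (T.cornerSliceAtlas₃ hc2 hη hL).hasHandleDecomposition_of_comp_val (F := P.secFun₃)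
    (fun q hq _ => P.contMDiffAt_secFun₃ hη hL hq) (fun p hp => ?_) (fun p hb => ?_) (fun p hb hpK => ?_)
    (fun p hi => ?_) (fun p hi hc => ?_) (fun i => ?_)
  · -- corner form `1 - u₃ v₃ / c₀ = G (cornerFold (Θ q))`, `G x = 1 - x₀/(2c₀)`
    refine ⟨fun y => 1 - (1 / (2 * P.c₀)) * y 0, ?_, ?_, fun q hq _ => ?_⟩
    · exact (contDiff_const.sub (contDiff_const.mul
        (EuclideanSpace.proj (0 : Fin 4) : EuclideanSpace ℝ (Fin 4) →L[ℝ] ℝ).contDiff)).contDiffAt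
    · -- `dG ≠ 0`
      have hG : HasFDerivAt (fun y : EuclideanSpace ℝ (Fin 4) => 1 - (1 / (2 * P.c₀)) * y 0)
          (-((1 / (2 * P.c₀)) • (EuclideanSpace.proj (0 : Fin 4) : EuclideanSpace ℝ (Fin 4) →L[ℝ] ℝ)))
          (cornerFold ((T.cornerSliceAtlas₃ hc2 hη hL |>.cornerDatum p hp).Θ p.1)) :=
        (((EuclideanSpace.proj (0 : Fin 4) : EuclideanSpace ℝ (Fin 4) →L[ℝ] ℝ).hasFDerivAt).const_mul
          (1 / (2 * P.c₀))).const_sub 1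
      rw [hG.fderiv]
      intro h
      have h1 : (-((1 / (2 * P.c₀)) • (EuclideanSpace.proj (0 : Fin 4) : EuclideanSpace ℝ (Fin 4) →L[ℝ] ℝ)))
          (EuclideanSpace.single 0 1) = -(1 / (2 * P.c₀)) := by
        show -((1 / (2 * P.c₀)) * (EuclideanSpace.single (0 : Fin 4) (1 : ℝ)) 0) = _
        simp
      rw [h] at h1
      have h2 : (0 : EuclideanSpace ℝ (Fin 4) →L[ℝ] ℝ) (EuclideanSpace.single 0 1) = 0 := rfl
      rw [h2] at h1
      have : (0 : ℝ) < 1 / (2 * P.c₀) := by have := P.c₀_pos; positivity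
      linarith
    · have hqb : q ∈ B.box T.D.εw := by
        change q ∈ B.wedgeSource (chartAt (EuclideanSpace ℝ (Fin 2)) (B.zL p.1)) T.D.εw at hq
        exact hq.1
      show P.secFun₃ q = 1 - 1 / (2 * P.c₀) * (cornerFold (((T.cornerSliceAtlas₃ hc2 hη hL).cornerDatum p hp).Θ q)) 0
      rw [P.secFun₃_of_mem_box hqb, cornerFold_apply_zero,
        ((T.cornerSliceAtlas₃ hc2 hη hL).cornerDatum p hp).apply_zero q hq,
        ((T.cornerSliceAtlas₃ hc2 hη hL).cornerDatum p hp).apply_one q hq]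
      ring
  · -- `= 1` on the boundary
    exact P.secFun₃_eq_one_of_boundary hc2 p.2 ((T.isBoundaryPoint_iff₃' hc2 hη hL p).1 hb)
  · -- regular on the boundary off `F`
    rcases (T.isBoundaryPoint_iff₃' hc2 hη hL p).1 hb with h | h0 | hM
    · exact absurd h hpK
    · exact P.not_isMCriticalPt_secFun₃_of_F₁_eq_zero hc2 hη hL p.2 h0 hpK
    · by_cases h0 : T.D.F₁ p.1 = 0
      · exact P.not_isMCriticalPt_secFun₃_of_F₁_eq_zero hc2 hη hL p.2 h0 hpK
      · exact P.not_isMCriticalPt_secFun₃_of_Mt_eq_zero hc2 hη hL p.2 h0 hM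
  · -- `< 1` inside
    obtain ⟨-, h0, hM⟩ := (T.isInteriorPoint_iff₃ hc2 hη hL p).1 hi
    exact P.secFun₃_lt_one_of_interior hc2 hη hL p.2 h0 hM
  · -- nondegenerate at interior critical points
    obtain ⟨-, h0, hM⟩ := (T.isInteriorPoint_iff₃ hc2 hη hL p).1 hi
    have hcf := P.isMCriticalPt_f_of_interior hc2 hη hL p.2 h0 hM hc
    have hs := P.sFun_gt_of_isMCriticalPt_f hη hL p.2 hcf
    have hev := P.secFun₃_eventuallyEq_affine hs
    have hev0 : P.secFun₃ =ᶠ[𝓝 p.1] fun y => ((1 + (1 + P.S) * T.c) - ((1 + P.S) * B.f y + 0)) + 0 :=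
      hev.trans (Eventually.of_forall fun y => (add_zero _).symm)
    rw [mhessian_congr_of_eventuallyEq_add_const hev0]
    exact hg'.2 _ ((isMCriticalPt_congr_of_eventuallyEq_add_const hev0).1 hc)
  · -- the count
    rw [P.image_interior_inter_criticalSetOfIndex hc2 hη hL i, countAbove]
    by_cases hi : i ≤ 4
    · rw [if_pos hi, if_pos hi]
    · rw [if_neg hi, if_neg hi, ncard_empty]

include P hc2 hη hL in
/-- **The handle decomposition of the straightened third sector, `handleCount` form**: if `f`
has one critical point of index `4`, `k` of index `3` and none of other indices above `c`, the
straightened `X₃` has a handle decomposition `handleCount 1 k` — the hypothesis `h₃` of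
`isGKTrisection_of_handles`. [cite: GayKirby2016, §4, Lemma 14] -/
theorem hasHandleDecomposition_X₃_handleCount {k : ℕ}
    (h4 : (criticalSetOfIndex (𝓡 4) B.f 4 ∩ B.f ⁻¹' Ioi T.c).ncard = 1)
    (h3 : (criticalSetOfIndex (𝓡 4) B.f 3 ∩ B.f ⁻¹' Ioi T.c).ncard = k)
    (hlt : ∀ i, i ≤ 2 → (criticalSetOfIndex (𝓡 4) B.f i ∩ B.f ⁻¹' Ioi T.c).ncard = 0) :
    letI := (T.cornerSliceAtlas₃ hc2 hη hL).chartedSpace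
    HasHandleDecomposition 3 T.X₃ (handleCount 1 k) := by
  have h := P.hasHandleDecomposition_X₃ hc2 hη hL
  have heq : countAbove B T = handleCount 1 k := by
    funext i
    simp only [countAbove, handleCount]
    rcases Nat.lt_or_ge i 5 with hi | hi
    · interval_cases i
      · simp [h4]
      · simp [h3]
      · simp [hlt 2 le_rfl]
      · simp [hlt 1 (by norm_num)]
      · simp [hlt 0 (by norm_num)]
    · have h1 : ¬ i ≤ 4 := by omega
      have h2 : i ≠ 0 := by omega
      have h3' : i ≠ 1 := by omega
      simp [h1, h2, h3']
  rw [heq] at h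
  exact h

end SectorThreeParams

/-- **Existence form**: under the smallness of the bevel slope, a bound `Γ` of `|G|`, a width
`σ₀ ≤ δ_U/2` and the gap hypothesis, the straightened third sector has a handle decomposition
with one handle of index `i` per critical point of `f` of index `4 - i` above `c`.
[cite: GayKirby2016, §4, Lemma 14] -/
theorem hasHandleDecomposition_X₃_of_small {B : BiCollar X} (T : B.TriData)
    (hc2 : B.a + B.U.δ + 2 * T.ε ≤ T.c) {η : ℝ} (hη : 2 * T.ε ≤ η)
    (hL : ∀ q : X, IsMCriticalPt (𝓡 4) B.f q → B.a < B.f q → B.f q ≤ T.c →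
      ∀ y : B.Y, RegularLevel.incl B.hf y ∈ stableSet (𝓡 4) B.U.ξ q → B.g y < B.b - η)
    {L Γ σ₀ : ℝ} (hLd : ∀ s, |deriv T.D.χ₁ s| ≤ L) (hκ : T.D.κ * L * T.D.χ₂.rOut ≤ 1 / 4)
    (hΓ : ∀ x, |B.gFun x| ≤ Γ) (hσ : 0 < σ₀) (hσδ : 2 * σ₀ ≤ B.U.δ)
    (hgap : ∀ q, IsMCriticalPt (𝓡 4) B.f q → B.f q ≤ T.c ∨ T.c + Γ + T.ε + σ₀ < B.f q) :
    letI := (T.cornerSliceAtlas₃ hc2 hη hL).chartedSpace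
    HasHandleDecomposition 3 T.X₃ (SectorThreeParams.countAbove B T) := by
  obtain ⟨P⟩ := T.nonempty_sectorThreeParams hLd hκ hΓ hσ hσδ hgap
  exact P.hasHandleDecomposition_X₃ hc2 hη hL

end TriData

end BiCollar

end Literature.Topology.FourManifolds

end
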